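import Literature.MathematicalPhysics.QuantumFieldTheory.Balaban1983to89.B8Ineq165AllLevels

/-!
# `Balaban1983to89.B8Ineq165GradedCover` — [Balaban1985RegularSpaces] p. 77 **(1.5)–(1.6)**, the tower decomposition
# «Λ_j = Ω_j^{(j)} ∖ Ω_{j+1}^{(j)}, Ω = ⋃_j Bʲ(Λ_j)» AT EVERY LEVEL: the law `h16` of `B8Ineq165AllLevels` DISCHARGED for layer-indexed
# region sequences (print's own `Λ_j` under (1.3)–(1.4)), and a kernel witness that it cannot be weakened to the level-`0` cover

statement-level skeleton of published theorems with citation tags; proofs where landed; nothing here is a claim about the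
Yang–Mills mass gap

PDF held: `paper:balaban1985-cmp99-regular-spaces-gauge-fixing` (journal page = PDF page + 74); p. 77 ((1.3)–(1.6), the bond convention),
p. 82 ((1.33)–(1.35)), p. 87 ((1.65)–(1.66)); text layer re-read for this file (pp. 77, 82, 87).

WHY THIS FILE (cell `pub-ymgap`, seat `pub-ymgap-dag-n04-b` g4, -b hand lent to DAG node N05 = [B8]; count-neutral; dag-lead DEDUP-95 re-point,
chair R453 (B)).  `B8Ineq165AllLevels.norm_avg_sub_le_allLevels_of135` (n05-a g6) is print's (1.65) «(1.33)–(1.35) ⇒ (1.66) on Ω_ℓ^{(ℓ)},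
ℓ = 0, …, k» with (1.35) on the LAYERS, under ONE region-sequence law carried as a hypothesis, `h16` = (1.6) AT EVERY LEVEL: «every
level-ℓ block `Bˡ(w) ⊂ Ω_ℓ` lies in a tower `Bʲ(y)`, `y ∈ Λ_j`, `ℓ ≤ j ≤ k`» (its header: «a HYPOTHESIS on the region sequence … not supplied
here»; the N05 index `B8LeafModelZd.ZdIdx` carries only the level-`0` cover `hpart`).  Print STATES (1.6) at level `0` (p. 77: *"Let us
denote Λ_j = Ω_j^{(j)} ∖ Ω_{j+1}^{(j)} … (1.5) thus we have Ω = ⋃_{j=0}^{k} Bʲ(Λ_j), where B⁰(Λ_0) = Λ_0. (1.6)"*) but DEFINES `Λ_j` by (1.5),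
and the same definition read at level `ℓ` gives `Ω_ℓ^{(ℓ)} = Λ_ℓ ∪ B(Ω_{ℓ+1}^{(ℓ+1)})`, whence `h16` by induction (dag-ref-A g9-1).  This file
supplies exactly that: `h16` PROVED (§1) — from the site-wise graded cover, from the tree's layers `B8Ineq132.layer` (= `Bʲ(Λ_j)` as site
sets), and, with NO residual hypothesis beyond print's (1.4) «Ω_j = B_j(Ω_j^{(j)})» (each `Ω_j` a union of level-`j` blocks), for PRINT'S
OWN `Λ_j` written at the `j`-lattice as `B8Ineq132.layer (fun i => {y | Bʲ(y) ⊂ Ω_i}) k j` = `Ω_j^{(j)} ∖ Ω_{j+1}^{(j)}` — so that (1.65)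
holds in print's geometry with no region law displayed (`norm_avg_sub_le_allLevels_print`, §2); and (§3) a kernel WITNESS that `h16`
is genuine content on a free index: with the level-`0` cover `hpart` alone (the `ZdIdx` law) every other hypothesis of
`norm_avg_sub_le_allLevels_of135` can hold while its conclusion fails at level `1`.

THE WITNESS (§3, `not_allLevels_of_cover_zero_only`).  `d = 2`, `L = 2`, `k = 1`, `Ω_j = ℤ²` for all `j`, `Λs 0 = ℤ²`, `Λs 1 = ∅`,
`U₀ = 1`, `U′ = h·1·h⁻¹` the pure gauge of `h(x) = u^{x₀}`, `u = (399 + 40i)/401 ∈ U(1)` (so `U′(x, x+e₀) = u⁻¹`, `U′(x, x+e₁) = 1`):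
the windows (`α₀ = 10⁻⁸`, `α₁ = |u − 1| ≤ 1/10`), unitarity, `Ω` antitone, towers in `Ω_j`, the level-`0` cover, (1.33)/(1.34)
(`B8Prop6OfThm4.one_inAk` + gauge invariance `B8Ineq132.inAk_gaugeAct_iff` — a pure gauge of unitaries is flat), (1.19)
(`InAx`: no tower of level `≥ 1`, vacuous) and (1.35) on the bonds touching `Λs j` (level `0`: `|u⁻¹ − 1|`, `0`) all hold, yet at the
level-`1` bond `⟨0, e₀⟩` (box in `Ω₁`) `‖Ū′¹ − 1‖ = |u⁻² − 1| > 1/9 > 11d²α₀ + α₁` — the average of a pure gauge is the pure gauge of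
the block corners ((11)/p. 24 of [Balaban1985Averaging], `B7Prop6Flat.avgIter_gaugeAct_units`).  Consequently `h16` fails there
(as `norm_avg_sub_le_allLevels_of135` would otherwise apply): the located design point №11 of the N05 pin is a real index law.

HONEST SCOPE.  (1) Nothing of (1.65) is re-proved: §2 is `norm_avg_sub_le_allLevels_of135` BY NAME with its two region binders
(`htower`, `h16`) discharged; the (1.66) currency is the tree's box form, as there.  (2) Print's (1.4) is used ONLY through its
first clause «Ω_j = B_j(Ω_j^{(j)})» (`hblk`: `Ω_j` a union of level-`j` blocks); the big-block size `M₁` and the metric clause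
`(Lʲη)⁻¹dist(Ω_jᶜ, Ω_{j+1}) > RM₁` are not needed for (1.65) and not assumed.  (3) No `def`: print's `Λ_j` is the displayed set
term, not a new declaration.  (4) The witness is a statement about the abstract hypothesis list (typing), not about print.
Count-neutral; N05 NOT discharged; nothing continuum / ℝ⁴ / OS / mass-gap / Clay.  Unit `pub-ymgap-dag-n04-b` (g4), 2026-08-26.
-/

noncomputable section

open scoped BigOperators

namespace Literature.MathematicalPhysics.QuantumFieldTheory.Balaban1983to89.B8Ineq165GradedCover

open B7Prop1Explicit B7Prop2Explicit B7Prop1Local B8Lemma1NonAbelian B8Ineq130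
open B8Ineq132 (InAk Under BondTouches layer exists_layer)
open B8Eq119TwistedAxial (InAx)
open B8Eq131Cubes (flm under_flm)
open B8Eq106Local (under_iff_tower)
open B8Ineq166Univ (flm_under_of_under)
open B8Ineq165AllLevels (norm_avg_sub_le_allLevels_of135)

-- `Site` alone would resolve to the torus sites of `Setup.lean`; re-export the `ℤ^d` sites of `B7Prop1Explicit`.
export B7Prop1Explicit (Site)

variable {d : ℕ}

/-! ## §1 The law `h16` («(1.6) at every level») proved: from the site-wise cover, from the layers, and for print's own `Λ_j` under (1.4) -/

/-- `x ∈ Bᵐ(z)` determines the label: `flm L m x = z` (floor division). [folklore] -/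
private theorem flm_eq_of_under_site {L : ℕ} (hL : 1 ≤ L) {m : ℕ} {z x : Site d} (hx : Under L m z x) : flm L m x = z := by
  funext i
  obtain ⟨h1, h2⟩ := hx i
  have hP : (0 : ℤ) < (L : ℤ) ^ m := by positivity
  have h3 : z i ≤ x i / (L : ℤ) ^ m := Int.le_ediv_of_mul_le hP (by rw [mul_comm]; exact h1)
  have h4 : x i / (L : ℤ) ^ m < z i + 1 :=
    Int.ediv_lt_of_lt_mul hP (by linarith [mul_comm ((L : ℤ) ^ m) (z i + 1)])
  show x i / (L : ℤ) ^ m = z i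
  omega

/-- The lower corner `Lˡw` of the block `Bˡ(w)` lies in it. [folklore] -/
private theorem under_tlo_self {L : ℕ} (hL : 1 ≤ L) (ℓ : ℕ) (w : Site d) : Under L ℓ w (tlo L w ℓ) :=
  (under_iff_tower L ℓ w _).2 ⟨le_rfl, fun i => tlo_le_thi hL le_rfl ℓ i⟩

/-- **`h16` from the site-wise graded cover**: if every SITE of `Ω_n` (`n ≤ k`) lies in a tower `Bʲ(y)`, `y ∈ Λs j`, of some level
`j ∈ [n, k]`, then every level-`ℓ` BLOCK `Bˡ(w) ⊂ Ω_ℓ` (`ℓ ≤ k`) lies in such a tower, `Bˡ(w) ⊂ Bʲ(y)` — the binder `h16` of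
`B8Ineq165AllLevels.norm_avg_sub_le_allLevels_of135` verbatim (apply the cover to the corner `Lˡw`; the level-`ℓ` label of a site of
`Bʲ(y)` lies under `y` at depth `j − ℓ`). [cite: Balaban1985RegularSpaces, (1.5)–(1.6) p.77] -/
theorem h16_of_siteCover {L : ℕ} (hL : 1 ≤ L) (k : ℕ) (Ω : ℕ → Set (Site d)) (Λs : ℕ → Set (Site d))
    (hcover : ∀ n, n ≤ k → ∀ x ∈ Ω n, ∃ j, n ≤ j ∧ j ≤ k ∧ ∃ y ∈ Λs j, InBox (tlo L y j) (thi L y j) x) :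
    ∀ ℓ, ℓ ≤ k → ∀ w : Site d, (∀ x, InBox (tlo L w ℓ) (thi L w ℓ) x → x ∈ Ω ℓ) →
      ∃ j, ℓ ≤ j ∧ j ≤ k ∧ ∃ y ∈ Λs j, Under L (j - ℓ) y w := by
  intro ℓ hℓ w hw
  have hwx : Under L ℓ w (tlo L w ℓ) := under_tlo_self hL ℓ w
  obtain ⟨j, hℓj, hj, y, hy, hxy⟩ := hcover ℓ hℓ _ (hw _ fun i => ⟨le_rfl, tlo_le_thi hL le_rfl ℓ i⟩)
  have hxu : Under L j y (tlo L w ℓ) := (under_iff_tower L j y _).2 ⟨fun i => (hxy i).1, fun i => (hxy i).2⟩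
  refine ⟨j, hℓj, hj, y, hy, ?_⟩
  have h := flm_under_of_under hL hℓj hxu
  rwa [flm_eq_of_under_site hL hwx] at h

/-- **`h16` from the layers** (dag-lead DEDUP-95's `h16_of_layers`): if every site of the layer `Bʲ(Λ_j)` = `Ω_j ∖ Ω_{j+1}` (`j < k`),
`Ω_k` (`j = k`) — the tree's `B8Ineq132.layer Ω k j` — lies in a tower `Bʲ(y)`, `y ∈ Λs j`, then `h16` holds: every level-`ℓ` block in
`Ω_ℓ` lies in a tower of some level `j ∈ [ℓ, k]` (print: «Ω = ⋃_{j=0}^{k} Bʲ(Λ_j)» (1.6), read at every level through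
`B8Ineq132.exists_layer`). [cite: Balaban1985RegularSpaces, (1.5)–(1.6) p.77] -/
theorem h16_of_layers {L : ℕ} (hL : 1 ≤ L) (k : ℕ) (Ω : ℕ → Set (Site d)) (Λs : ℕ → Set (Site d))
    (hlayer : ∀ j, j ≤ k → ∀ x ∈ layer Ω k j, ∃ y ∈ Λs j, InBox (tlo L y j) (thi L y j) x) :
    ∀ ℓ, ℓ ≤ k → ∀ w : Site d, (∀ x, InBox (tlo L w ℓ) (thi L w ℓ) x → x ∈ Ω ℓ) →
      ∃ j, ℓ ≤ j ∧ j ≤ k ∧ ∃ y ∈ Λs j, Under L (j - ℓ) y w := by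
  refine h16_of_siteCover hL k Ω Λs fun n hn x hx => ?_
  obtain ⟨l, hnl, hlk, hxl⟩ := exists_layer hn hx
  obtain ⟨y, hy, hxy⟩ := hlayer l hlk x hxl
  exact ⟨l, hnl, hlk, y, hy, hxy⟩

/-- **The tower law for PRINT'S `Λ_j`** (1.5) `Λ_j = Ω_j^{(j)} ∖ Ω_{j+1}^{(j)}`, written at the `j`-lattice as
`layer (fun i => {y | Bʲ(y) ⊂ Ω_i}) k j`: `Bʲ(y) ⊂ Ω_j` for `y ∈ Λ_j` — the binder `htower` of `norm_avg_sub_le_allLevels_of135`, by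
definition. [cite: Balaban1985RegularSpaces, (1.5) p.77] -/
theorem htower_of_blockUnion (L k : ℕ) (Ω : ℕ → Set (Site d)) :
    ∀ j, j ≤ k → ∀ y ∈ layer (fun i => {y : Site d | ∀ x, InBox (tlo L y j) (thi L y j) x → x ∈ Ω i}) k j,
      ∀ x, InBox (tlo L y j) (thi L y j) x → x ∈ Ω j :=
  fun _ _ _ hy x hx => hy.1 x hx

/-- **`h16` for PRINT'S `Λ_j` under (1.4)** («Ω_j = B_j(Ω_j^{(j)})»: each `Ω_j`, `j ≤ k`, is a union of level-`j` blocks — `hblk`): every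
level-`ℓ` block `Bˡ(w) ⊂ Ω_ℓ` (`ℓ ≤ k`) lies in a tower `Bʲ(y)` with `y ∈ Λ_j = Ω_j^{(j)} ∖ Ω_{j+1}^{(j)}`, `ℓ ≤ j ≤ k` — i.e. (1.6)
at every level, `Ω_ℓ^{(ℓ)} = ⋃_{j ≥ ℓ} B^{j−ℓ}(Λ_j)`, is AUTOMATIC in print's geometry (take the largest `j ∈ [ℓ, k]` with the corner
`Lˡw ∈ Ω_j`, `B8Ineq132.exists_layer`, and `y` its level-`j` label). [cite: Balaban1985RegularSpaces, (1.4)–(1.6) p.77] -/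
theorem h16_of_blockUnion {L : ℕ} (hL : 1 ≤ L) (k : ℕ) (Ω : ℕ → Set (Site d))
    (hblk : ∀ j, j ≤ k → ∀ x ∈ Ω j, ∀ x', Under L j (flm L j x) x' → x' ∈ Ω j) :
    ∀ ℓ, ℓ ≤ k → ∀ w : Site d, (∀ x, InBox (tlo L w ℓ) (thi L w ℓ) x → x ∈ Ω ℓ) →
      ∃ j, ℓ ≤ j ∧ j ≤ k ∧ ∃ y ∈ layer (fun i => {y : Site d | ∀ x, InBox (tlo L y j) (thi L y j) x → x ∈ Ω i}) k j,
        Under L (j - ℓ) y w := by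
  intro ℓ hℓ w hw
  have hwx : Under L ℓ w (tlo L w ℓ) := under_tlo_self hL ℓ w
  have hxΩ : tlo L w ℓ ∈ Ω ℓ := hw _ fun i => ⟨le_rfl, tlo_le_thi hL le_rfl ℓ i⟩
  obtain ⟨l, hℓl, hlk, hxl⟩ := exists_layer hℓ hxΩ
  refine ⟨l, hℓl, hlk, flm L l (tlo L w ℓ), ⟨?_, fun hlt hsub => hxl.2 hlt ?_⟩, ?_⟩
  · -- `Bˡ(y) ⊂ Ω_l`: `Ω_l` is a union of level-`l` blocks and contains the corner
    intro x hx
    exact hblk l hlk _ hxl.1 x ((under_iff_tower L l _ x).2 ⟨fun i => (hx i).1, fun i => (hx i).2⟩)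
  · -- `Bˡ(y) ⊄ Ω_{l+1}` for `l < k`: the corner lies in `Bˡ(y)` but not in `Ω_{l+1}`
    have h := (under_iff_tower L l _ _).1 (under_flm hL l (tlo L w ℓ))
    exact hsub _ fun i => ⟨h.1 i, h.2 i⟩
  · have h := flm_under_of_under hL hℓl (under_flm hL l (tlo L w ℓ))
    rwa [flm_eq_of_under_site hL hwx] at h

/-! ## §2 (1.65) in print's geometry: (1.3), (1.4), (1.33)–(1.35) on print's `Λ_j` ⇒ (1.66) at every level, no region law displayed -/

section Print

variable {𝔸 : Type*} [CStarAlgebra 𝔸] [Nontrivial 𝔸]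

/-- **(1.65) AT EVERY LEVEL IN PRINT'S OWN GEOMETRY** (p. 87 «Thus the conditions (1.33)–(1.35) imply |Ũ′ʲ − 1| < 11d²α₀ + α₁ on
Ω_j^{(j)}», `j = 0, …, k`): for a region sequence (1.3) `Ω_0 ⊇ Ω_1 ⊇ …` with (1.4) «Ω_j = B_j(Ω_j^{(j)})» (`Ω_j` a union of level-`j`
blocks, `j ≤ k`) and PRINT'S `Λ_j = Ω_j^{(j)} ∖ Ω_{j+1}^{(j)}` (1.5) (the displayed `layer (fun i => {y | Bʲ(y) ⊂ Ω_i}) k j`), unitary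
`U₀`, `U′` with (1.33) `U₀ ∈ 𝔄_k({Ω_j}, α₀)`, (1.34) `U′U₀ ∈ 𝔄_k({Ω_j}, α₀) ∩ Ax_k(𝔅_k, U₀)`, (1.35) `|(\overline{U′U₀})ʲ − Ū₀ʲ| ≤ α₁`
on the level-`j` bonds touching `Λ_j` (p. 77 convention; box in `Ω_j`) and the windows of (1.65): (1.66) in the tree's box currency at
EVERY level, `‖(\overline{U′U₀})ˡ − Ū₀ˡ‖ ≤ 11d²α₀ + α₁` on every level-`ℓ` bond whose box lies in `Ω_ℓ`, `ℓ ≤ k` — n05-a's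
`B8Ineq165AllLevels.norm_avg_sub_le_allLevels_of135` BY NAME with `htower`, `h16` discharged by §1.
[cite: Balaban1985RegularSpaces, (1.65)–(1.66) p.87, (1.33)–(1.35) p.82, (1.3)–(1.6) p.77] -/
theorem norm_avg_sub_le_allLevels_print (hd : 1 ≤ d) {L : ℕ} (hL : 2 ≤ L) (k : ℕ) {η : ℝ}
    {U₀ U' : Site d → Fin d → 𝔸ˣ} (hU₀ : ∀ x κ, U₀ x κ ∈ unitaryUnits 𝔸) (hU' : ∀ x κ, U' x κ ∈ unitaryUnits 𝔸)
    {α₀ α₁ : ℝ} (hα₀ : 0 < α₀) (hα3 : C0 d * α₀ ≤ 1 / 3) (hα2 : 2 * α₀ ≤ c2' d L) (hα₁ : 0 ≤ α₁)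
    (hsmall : 11 * (d : ℝ) ^ 2 * α₀ + α₁ ≤ 1 / 6)
    (Ω : ℕ → Set (Site d)) (hΩ : ∀ j, Ω (j + 1) ⊆ Ω j)
    (hblk : ∀ j, j ≤ k → ∀ x ∈ Ω j, ∀ x', Under L j (flm L j x) x' → x' ∈ Ω j)
    (h33 : InAk L k η α₀ Ω U₀) (h34 : InAk L k η α₀ Ω (mulCfg U' U₀))
    (hAx : InAx L k (fun j => layer (fun i => {y : Site d | ∀ x, InBox (tlo L y j) (thi L y j) x → x ∈ Ω i}) k j) U₀
      (mulCfg U' U₀))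
    (h35 : ∀ j, j ≤ k → ∀ (z : Site d) (μ : Fin d),
      BondTouches (layer (fun i => {y : Site d | ∀ x, InBox (tlo L y j) (thi L y j) x → x ∈ Ω i}) k j) z μ →
      (∀ x, InBox (loK L j z) (bondHiK L j z μ) x → x ∈ Ω j) →
      ‖(avgIter L (mulCfg U' U₀) j z μ : 𝔸) - (avgIter L U₀ j z μ : 𝔸)‖ ≤ α₁)
    {ℓ : ℕ} (hℓ : ℓ ≤ k) (w : Site d) (ν : Fin d) (hbox : ∀ x, InBox (loK L ℓ w) (bondHiK L ℓ w ν) x → x ∈ Ω ℓ) :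
    ‖(avgIter L (mulCfg U' U₀) ℓ w ν : 𝔸) - (avgIter L U₀ ℓ w ν : 𝔸)‖ ≤ 11 * (d : ℝ) ^ 2 * α₀ + α₁ :=
  norm_avg_sub_le_allLevels_of135 hd hL k hU₀ hU' hα₀ hα3 hα2 hα₁ hsmall Ω hΩ _ (htower_of_blockUnion L k Ω)
    (h16_of_blockUnion (le_trans (by norm_num) hL) k Ω hblk) h33 h34 hAx h35 hℓ w ν hbox

end Print

/-! ## §3 `h16` is genuine content on a free index: the level-`0` cover (`ZdIdx.hpart`) does not suffice -/

section Witness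

open B7AvgGaugeCovariance (uLev uLev_apply)
open B7Prop6Flat (avgIter_gaugeAct_units)
open B8Prop6OfThm4 (one_inAk)
open B8Ineq132 (inAk_gaugeAct_iff avgIter_one)

/-- **`h16` cannot be weakened to the level-`0` cover** (typing witness for the N05 index `B8LeafModelZd.ZdIdx`, whose `hpart` is the
cover of `Ω₀` only): on `ℤ²` with `L = 2`, `k = 1`, `Ω_j = ℤ²` (all `j`), `Λs 0 = ℤ²`, `Λs 1 = ∅`, `U₀ = 1` and `U′` the pure gauge
`h(x)h(x + e_μ)⁻¹`, `h(x) = u^{x₀}`, `u = (399 + 40i)/401 ∈ U(1)`, EVERY hypothesis of `B8Ineq165AllLevels.norm_avg_sub_le_allLevels_of135`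
other than `h16` holds together with the level-`0` cover — windows (`α₀ = 10⁻⁸`, `α₁ = |u − 1| ≤ 1/10`), unitarity, `Ω` antitone, towers
in `Ω_j`, `hpart`, (1.33)/(1.34) (`U′` is flat), (1.19) (vacuous), (1.35) on the bonds touching `Λs j` — yet at the level-`1` bond
`⟨0, e₀⟩` (box in `Ω₁`) `‖(\overline{U′U₀})¹ − Ū₀¹‖ = |u² − 1| > 1/9 > 11d²α₀ + α₁` (gauge covariance (11)/(45) of the averages of
[3], `B7Prop6Flat.avgIter_gaugeAct_units`: the average of a pure gauge is the pure gauge of the block corners); hence `h16` fails there.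
[cite: Balaban1985RegularSpaces, (1.5)–(1.6) p.77, (1.65) p.87] -/
theorem not_allLevels_of_cover_zero_only :
    ∃ (η α₀ α₁ : ℝ) (Ω : ℕ → Set (Site 2)) (Λs : ℕ → Set (Site 2)) (U₀ U' : Site 2 → Fin 2 → ℂˣ),
      0 < η ∧ 0 < α₀ ∧ C0 2 * α₀ ≤ 1 / 3 ∧ 2 * α₀ ≤ c2' 2 2 ∧ 0 ≤ α₁ ∧ 11 * (2 : ℝ) ^ 2 * α₀ + α₁ ≤ 1 / 6 ∧
      (∀ x κ, U₀ x κ ∈ unitaryUnits ℂ) ∧ (∀ x κ, U' x κ ∈ unitaryUnits ℂ) ∧ (∀ j, Ω (j + 1) ⊆ Ω j) ∧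
      (∀ j, j ≤ 1 → ∀ y ∈ Λs j, ∀ x, InBox (tlo 2 y j) (thi 2 y j) x → x ∈ Ω j) ∧
      (∀ x ∈ Ω 0, ∃ j, j ≤ 1 ∧ ∃ y ∈ Λs j, InBox (tlo 2 y j) (thi 2 y j) x) ∧
      InAk 2 1 η α₀ Ω U₀ ∧ InAk 2 1 η α₀ Ω (mulCfg U' U₀) ∧ InAx 2 1 Λs U₀ (mulCfg U' U₀) ∧
      (∀ j, j ≤ 1 → ∀ (z : Site 2) (μ : Fin 2), BondTouches (Λs j) z μ →
        (∀ x, InBox (loK 2 j z) (bondHiK 2 j z μ) x → x ∈ Ω j) →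
        ‖(avgIter 2 (mulCfg U' U₀) j z μ : ℂ) - (avgIter 2 U₀ j z μ : ℂ)‖ ≤ α₁) ∧
      (∀ x, InBox (loK 2 1 (0 : Site 2)) (bondHiK 2 1 (0 : Site 2) 0) x → x ∈ Ω 1) ∧
      11 * (2 : ℝ) ^ 2 * α₀ + α₁ < ‖(avgIter 2 (mulCfg U' U₀) 1 0 0 : ℂ) - (avgIter 2 U₀ 1 0 0 : ℂ)‖ := by
  -- the unitary `u = (399 + 40 i)/401` and its inverse
  set zc : ℂ := ⟨399 / 401, 40 / 401⟩ with hzc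
  set zi : ℂ := ⟨399 / 401, -(40 / 401)⟩ with hzi
  have hstar : star zc = zi := by
    apply Complex.ext <;> simp [hzc, hzi]
  have hmul : zc * zi = 1 := by
    apply Complex.ext <;> simp [hzc, hzi, Complex.mul_re, Complex.mul_im] <;> norm_num
  have hmul' : zi * zc = 1 := by rw [mul_comm]; exact hmul
  set u : ℂˣ := ⟨zc, zi, hmul, hmul'⟩ with hu_def
  have hu : u ∈ unitaryUnits ℂ := by
    rw [mem_unitaryUnits, Unitary.mem_iff]
    exact ⟨by rw [hstar]; exact hmul', by rw [hstar]; exact hmul⟩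
  -- the two norms: `|u⁻¹ − 1| ≤ 1/10`, `|u⁻² − 1| > 1/9`
  have hn1 : ‖zi - 1‖ ≤ 1 / 10 := by
    have hsq : ‖zi - 1‖ ^ 2 ≤ (1 / 10) ^ 2 := by
      rw [← Complex.normSq_eq_norm_sq, Complex.normSq_apply]
      simp [hzi]
      norm_num
    exact (pow_le_pow_iff_left₀ (norm_nonneg _) (by norm_num) two_ne_zero).1 hsq
  have hn2 : 1 / 9 < ‖zi * zi - 1‖ := by
    have hsq : (1 / 9 : ℝ) ^ 2 < ‖zi * zi - 1‖ ^ 2 := by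
      rw [← Complex.normSq_eq_norm_sq, Complex.normSq_apply]
      simp [hzi, Complex.mul_re, Complex.mul_im]
      norm_num
    exact (pow_lt_pow_iff_left₀ (by norm_num) (norm_nonneg _) two_ne_zero).1 hsq
  -- the pure gauge `U′ = h·1·h⁻¹`, `h(x) = u^{x₀}`
  set h : Site 2 → ℂˣ := fun x => u ^ (x 0) with hh_def
  have hh : ∀ x, h x ∈ unitaryUnits ℂ := fun x => (unitaryUnits ℂ).zpow_mem hu _
  have hh1 : ∀ x, h x ∈ U1 ℂ := fun x => unitaryUnits_le_U1 (hh x)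
  set U' : Site 2 → Fin 2 → ℂˣ := gaugeAct h 1 with hU'_def
  have hU'val : ∀ (x : Site 2) (μ : Fin 2), U' x μ = h x * (h (x + e μ))⁻¹ := by
    intro x μ
    simp [hU'_def, gaugeAct]
  have hU'0 : ∀ x : Site 2, U' x 0 = u⁻¹ := by
    intro x
    rw [hU'val]
    simp only [hh_def, add_e_apply, if_true]
    group
  have hU'1 : ∀ x : Site 2, U' x 1 = 1 := by
    intro x
    rw [hU'val]
    have h10 : (x + e (1 : Fin 2) : Site 2) 0 = x 0 := by rw [add_e_apply]; simp
    simp only [hh_def]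
    rw [h10, mul_inv_cancel]
  have hU'u : ∀ x κ, U' x κ ∈ unitaryUnits ℂ := by
    intro x κ
    rw [hU'val]
    exact (unitaryUnits ℂ).mul_mem (hh x) ((unitaryUnits ℂ).inv_mem (hh _))
  have hmc : mulCfg U' (1 : Site 2 → Fin 2 → ℂˣ) = U' := by
    funext x κ; simp [mulCfg]
  -- the level-1 average of the pure gauge at the bond ⟨0, e₀⟩ is `u⁻²`
  have havg : avgIter 2 U' 1 0 0 = u⁻¹ * u⁻¹ := by
    rw [hU'_def, avgIter_gaugeAct_units 2 h 1 1, avgIter_one]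
    simp only [gaugeAct, Pi.one_apply, mul_one, uLev_apply, zero_add, smul_zero, hh_def]
    have h2 : (((2 : ℕ) : ℤ) ^ 1 • e (0 : Fin 2)) 0 = 2 := by simp [e_apply]
    rw [h2]
    have h0 : (0 : Site 2) 0 = 0 := rfl
    rw [h0, zpow_zero, one_mul]
    group
  refine ⟨1, 1 / 100000000, ‖zi - 1‖, fun _ => Set.univ, fun j => {_y | j = 0}, 1, U', one_pos, by norm_num,
    by norm_num [C0], by norm_num [c2'], norm_nonneg _, by linarith, fun _ _ => Submonoid.one_mem _, hU'u,
    fun _ => le_rfl, fun _ _ _ _ _ _ => Set.mem_univ _, ?_, one_inAk (by norm_num) 1 one_pos (by norm_num) _, ?_, ?_,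
    ?_, fun _ _ => Set.mem_univ _, ?_⟩
  · -- the cover of `Ω₀` by the level-0 towers (= `ZdIdx.hpart`)
    intro x _
    exact ⟨0, Nat.zero_le 1, x, rfl, fun i => ⟨by simp, by simp⟩⟩
  · -- (1.34), first part: a pure gauge of unitaries is as regular as `1`
    rw [hmc, hU'_def, inAk_gaugeAct_iff 2 1 1 (1 / 100000000) _ hh1]
    exact one_inAk (by norm_num) 1 one_pos (by norm_num) _
  · -- (1.19): no tower of level ≥ 1
    intro j hj1 _ xj hxj
    exact absurd hxj (by simp only [Set.mem_setOf_eq]; omega)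
  · -- (1.35) on the bonds touching `Λs j`: level 0 only, `|U′_b − 1| ∈ {|u⁻¹ − 1|, 0}`
    intro j hj z μ htouch _
    have hj0 : j = 0 := by
      rcases htouch with ht | ht <;> simpa only [Set.mem_setOf_eq] using ht
    subst hj0
    rw [hmc, avgIter_zero, avgIter_zero, Pi.one_apply, Pi.one_apply, Units.val_one]
    have hμ : μ = 0 ∨ μ = 1 := by fin_cases μ <;> simp
    rcases hμ with rfl | rfl
    · rw [hU'0]; exact le_rfl
    · rw [hU'1, Units.val_one, sub_self, norm_zero]; exact norm_nonneg _
  · -- the failure at the level-1 bond ⟨0, e₀⟩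
    rw [hmc, havg, avgIter_one, Pi.one_apply, Pi.one_apply, Units.val_one, Units.val_mul]
    have hval : ((u⁻¹ : ℂˣ) : ℂ) = zi := rfl
    rw [hval]
    have hα : 11 * (2 : ℝ) ^ 2 * (1 / 100000000) + ‖zi - 1‖ < 1 / 9 := by linarith
    exact hα.trans hn2

/-- **Corollary of the witness: `h16` itself fails on that index** — with `Ω_j = ℤ²`, `Λs 0 = ℤ²`, `Λs 1 = ∅`, the level-`1` block `B¹(0) ⊂ Ω₁`
lies in no tower of level `≥ 1`, although the level-`0` cover `hpart` holds. [cite: Balaban1985RegularSpaces, (1.5)–(1.6) p.77] -/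
theorem not_h16_of_cover_zero_only :
    ∃ (Ω : ℕ → Set (Site 2)) (Λs : ℕ → Set (Site 2)),
      (∀ j, Ω (j + 1) ⊆ Ω j) ∧ (∀ j, j ≤ 1 → ∀ y ∈ Λs j, ∀ x, InBox (tlo 2 y j) (thi 2 y j) x → x ∈ Ω j) ∧
      (∀ x ∈ Ω 0, ∃ j, j ≤ 1 ∧ ∃ y ∈ Λs j, InBox (tlo 2 y j) (thi 2 y j) x) ∧
      ¬ (∀ ℓ, ℓ ≤ 1 → ∀ w : Site 2, (∀ x, InBox (tlo 2 w ℓ) (thi 2 w ℓ) x → x ∈ Ω ℓ) →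
          ∃ j, ℓ ≤ j ∧ j ≤ 1 ∧ ∃ y ∈ Λs j, Under 2 (j - ℓ) y w) := by
  refine ⟨fun _ => Set.univ, fun j => {_y | j = 0}, fun _ => le_rfl, fun _ _ _ _ _ _ => Set.mem_univ _,
    fun x _ => ⟨0, Nat.zero_le 1, x, rfl, fun i => ⟨by simp, by simp⟩⟩, fun h16 => ?_⟩
  obtain ⟨j, h1j, hj1, y, hy, _⟩ := h16 1 le_rfl 0 fun _ _ => Set.mem_univ _
  have hj0 : j = 0 := by simpa only [Set.mem_setOf_eq] using hy
  omega

end Witness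

#print axioms h16_of_blockUnion
#print axioms norm_avg_sub_le_allLevels_print
#print axioms not_allLevels_of_cover_zero_only
#print axioms not_h16_of_cover_zero_only

end Literature.MathematicalPhysics.QuantumFieldTheory.Balaban1983to89.B8Ineq165GradedCover

end
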